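import Summits.HodgeConjecture.HodgeConjecture.Theorems.Ring2DeformAnchoredFamilies
import Literature.AlgebraicGeometry.HodgeTheory.HodgeClassesTwoCMCurvesProducts
import HarnessLib

/-!
# Ring 2 · deform axis, part XII — two-CM-curve anchors: the biquadratic K3-partner rows in the kernel

HONEST FRAMING (cell `pub-hodge-ring2`, verbatim): research route conditional on HC_CM; not a corollary;
Q11.4-sentence-2 already refuted in dim ≥ 3.

`HC_CM` := `Theses.RankFourFaces.CMAbelianHodge` (stmt-HodgeConjecture-3052) does NOT occur in this file, and NO named
Literature fact is used: the Hodge conjecture for every complex abelian variety isogenous to a product of copies of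
TWO elliptic curves `E₁`, `E₂` with complex multiplications `ψ₁² = -d₁`, `ψ₂² = -d₂`, `d₁ d₂` not a square
(different CM fields) is now a THEOREM of the tree (`HodgeTheory.hodgeConjectureFor_of_isIsogenous_of_twoCMSlots`,
van Geemen's `B = D` for such products + Lefschetz (1,1) + isogeny invariance; unconditional). This part reads it
on the deformation axis exactly as parts IX §2 / X §2 read the one-curve theorem:

§1 MEMBERS. HC, hence the localised row U `CMSpreadingAt` of part VII, at every abelian variety of one of the shapes
   `A ~ E₁^{a+1} × E₂^{b+1}`; `X ~ Y₀ × Z`, `Y₀ ~ E₁^{a+1} × E₂^{b+1}`, `Z ~ E₁^{c+1} × E₂^{e+1}`; and `X ~ Y₀ × Z`,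
   `Y₀ ~ E₁^{a+1} × E₂^{b+1}`, `Z ~ E₁^{c+1}`. These are the CM fibres of RING2-MAP §deform D.41 row (3), `E`
   BIQUADRATIC (`E = k₁ k₂ E⁺`): on the Shimura curve of a simple type IV(2,1) fourfold `Y` with `End⁰(Y) = E` the
   `E × E` tori have `Y_h ~ E_{k₁}² × E_{k₂}²`, the K3 partner is `Z_Y ~ E_{k₁} × E_{k₂}`, so the K3-partner sixfold
   has CM fibres `X_h ~ Y_h × Z_Y` (member (i): `(a,b,c,e) = (1,1,0,0)`), and the Weil member (ii) `Y × E_{k₁}²` has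
   CM fibres `Y_h × E_{k₁}²` (`(a,b,c) = (1,1,1)`); also the diagonal fibres of row (1) with two distinct fields
   among `K₁, K₂, K₃` (normal form `E₁^{4} × E₂^{2}`). Gen 12 recorded these rows as "free IN PRINT" (Abdulali's
   survey, App. A 3(c), after Imai 1976); they are now free IN THE KERNEL with no fact — the same status as the
   `E` cyclic row has modulo Tankeev–Ribet (IX §2 `…_prod_sq_of_tankeevRibet`), here WITHOUT Tankeev–Ribet.
§2 FAMILIES. On a family `f` satisfying Abdulali's invariant-cycles property (1.1) (`InvariantCyclesHoldFor f n`, a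
   PREDICATE — nothing is asserted about any family) one fibre of which is charted by such a product, the localised
   row U holds at EVERY fibre and HC holds at every HODGE-GENERIC fibre (`HodgeClassesExtendAt`) — part X §1 with the
   anchor supplied by §1. Reading (D.46, `E` biquadratic line, now fact-free): HC(`Y × Z_Y`) ⟸ (1.1) on the ONE
   compact Mumford–Tate curve of `Y × Z_Y` (every abelian variety is Hodge-generic in its own Mumford–Tate family).
   Instances: the K3-QUOTIENT anchors of atlas-2 for `E = ℚ(ζ₈) ⊃ ℚ(i), ℚ(√-2)` (`(d₁,d₂) = (1,2)`) and
   `E = ℚ(ζ₁₂) ⊃ ℚ(i), ℚ(√-3)` (`(d₁,d₂) = (1,3)`).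

What this does NOT say: that any particular family satisfies (1.1) (OPEN — node (CS) of part I up to the anchor),
that a given fibre is Hodge-generic, or which CM points lie on which family: the isogeny shapes `hA`/`hX hY hZ` are
HYPOTHESES here, determined and certified by two methods in RING2-MAP §deform D.41 (CM-type calculus ‖ habitat
T8-A, HA46). Nothing here decides `HC_CM`, `HC_AV` or any atlas cell; no definition, no new node, no `sorry`.

Sources: [van Geemen 1994, LNM 1594, Thm. 4.3 and Lemma 3.7]; [Moonen–Zarhin 1999 = arXiv:math/9901113, §3
Cor. (3.9) (after Imai) and §4 (quartic CM fields, arXiv p. 8)]; [Abdulali 1994, (1.1) p. 1122 and Lemma 6.2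
p. 1131]; [Deligne 1982, §6 Prop. 6.1]; [Charles–Schnell 2014 = arXiv:1101.3647, Prop. 11.3.5, Thm. 11.5.11];
[Kerr (ed.) 2016, Abdulali's survey, App. A 3(c) — the printed statement for three curves].
-/

set_option linter.dupNamespace false

noncomputable section

namespace Summit.HodgeConjecture.HodgeConjecture.Ring2.Deform

open CategoryTheory AlgebraicGeometry
open Literature.AlgebraicGeometry Literature.AlgebraicGeometry.Motives
open Literature.AlgebraicGeometry.HodgeTheory
open Literature.AlgebraicTopology.SingularHomology
open Literature.AlgebraicGeometry.Abdulali1994 (InvariantCyclesHoldFor)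
open Summit.HodgeConjecture.HodgeConjecture
open Summit.HodgeConjecture.HodgeConjecture.Ring2.Hypotheses (anchorLocus mem_anchorLocus_of_chart
  HodgeClassesExtendAt forall_mem_algebraicClasses_of_invariantCycles_of_anchor
  hodgeConjectureFor_fiber_of_invariantCycles_of_anchor_of_extend)


variable {𝒳 S : SchemeOver ℂ}

section TwoCMCurves

variable {E₁ E₂ : AbelianVariety ℂ} (hE₁ : E₁.dim = 1) (hE₂ : E₂.dim = 1) {ψ₁ : E₁ ⟶ E₁} {ψ₂ : E₂ ⟶ E₂}
  {d₁ d₂ : ℕ} (hd₁ : 0 < d₁) (hd₂ : 0 < d₂) (hψ₁ : ψ₁ ≫ ψ₁ = -(d₁ • 𝟙 E₁)) (hψ₂ : ψ₂ ≫ ψ₂ = -(d₂ • 𝟙 E₂))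
  (hsq : ¬ IsSquare (d₁ * d₂))
include hE₁ hE₂ hd₁ hd₂ hψ₁ hψ₂ hsq

/-! ## §1 — Members: products of copies of two CM elliptic curves with different CM fields -/

/-- **HC for every `A ~ (E₁^{a+1} × E₂^{b+1}) × (E₁^{c+1} × E₂^{e+1})`** — two blocks of the two curves, any
exponents (the slot structures of the tree's two-curve theorem are closed under products in any bracketing).
UNCONDITIONAL: no `HC_CM`, no named fact. [cite: vanGeemen1994HodgeAV, Thm. 4.3 and Lemma 3.7]
[cite: MoonenZarhin1999LowDim, §3 Cor. (3.9)] -/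
theorem hodgeConjectureFor_of_isIsogenous_twoCMCurves_prod (a b c e : ℕ) {A : AbelianVariety ℂ}
    (hA : A.IsIsogenous (((E₁.powSucc a).prod (E₂.powSucc b)).prod ((E₁.powSucc c).prod (E₂.powSucc e)))) :
    HodgeConjectureFor A.dim A.X := by
  let E : Bool → AbelianVariety ℂ := fun t ↦ bif t then E₁ else E₂
  let ψ : ∀ t, E t ⟶ E t := fun t ↦ match t with
    | true => ψ₁
    | false => ψ₂
  let d : Bool → ℕ := fun t ↦ bif t then d₁ else d₂
  have hE : ∀ t, (E t).dim = 1 := by rintro (_ | _) <;> assumption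
  have hd : ∀ t, 0 < d t := by rintro (_ | _) <;> assumption
  have hψ : ∀ t, ψ t ≫ ψ t = -(d t • 𝟙 (E t)) := by rintro (_ | _) <;> assumption
  obtain ⟨ω, hω, hω0, hgen⟩ := exists_generators hE
  exact hodgeConjectureFor_of_isIsogenous_of_twoCMSlots (E := E) (ψ := ψ) (d := d) hE hd hψ hsq hω hω0 hgen hA
    ((((twoCMSlots_self (ψ := ψ) true (hgen true)).powSucc a).prod
      ((twoCMSlots_self (ψ := ψ) false (hgen false)).powSucc b)).prod
     (((twoCMSlots_self (ψ := ψ) true (hgen true)).powSucc c).prod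
      ((twoCMSlots_self (ψ := ψ) false (hgen false)).powSucc e)))

/-- **HC for every `A ~ (E₁^{a+1} × E₂^{b+1}) × E₁^{c+1}`** (one two-curve block times a power of the first
curve). UNCONDITIONAL: no `HC_CM`, no named fact. [cite: vanGeemen1994HodgeAV, Thm. 4.3 and Lemma 3.7]
[cite: MoonenZarhin1999LowDim, §3 Cor. (3.9)] -/
theorem hodgeConjectureFor_of_isIsogenous_twoCMCurves_prod_powSucc (a b c : ℕ) {A : AbelianVariety ℂ}
    (hA : A.IsIsogenous (((E₁.powSucc a).prod (E₂.powSucc b)).prod (E₁.powSucc c))) :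
    HodgeConjectureFor A.dim A.X := by
  let E : Bool → AbelianVariety ℂ := fun t ↦ bif t then E₁ else E₂
  let ψ : ∀ t, E t ⟶ E t := fun t ↦ match t with
    | true => ψ₁
    | false => ψ₂
  let d : Bool → ℕ := fun t ↦ bif t then d₁ else d₂
  have hE : ∀ t, (E t).dim = 1 := by rintro (_ | _) <;> assumption
  have hd : ∀ t, 0 < d t := by rintro (_ | _) <;> assumption
  have hψ : ∀ t, ψ t ≫ ψ t = -(d t • 𝟙 (E t)) := by rintro (_ | _) <;> assumption
  obtain ⟨ω, hω, hω0, hgen⟩ := exists_generators hE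
  exact hodgeConjectureFor_of_isIsogenous_of_twoCMSlots (E := E) (ψ := ψ) (d := d) hE hd hψ hsq hω hω0 hgen hA
    ((((twoCMSlots_self (ψ := ψ) true (hgen true)).powSucc a).prod
      ((twoCMSlots_self (ψ := ψ) false (hgen false)).powSucc b)).prod
     ((twoCMSlots_self (ψ := ψ) true (hgen true)).powSucc c))

/-- **Row U at `A ~ E₁^{a+1} × E₂^{b+1}` WITHOUT `HC_CM`**: the localised row U of part VII (`CMSpreadingAt`) holds
at every such abelian variety because HC does (`HodgeTheory.hodgeConjectureFor_of_isIsogenous_twoCMCurves`). Cases: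
`Z_Y ~ E_{k₁} × E_{k₂}` and `Y_h ~ E_{k₁}² × E_{k₂}²` themselves; the diagonal fibres of D.41 row (1) with exactly
two distinct fields (`E_{K₁}⁴ × E_{K₂}²`).
[cite: vanGeemen1994HodgeAV, Thm. 4.3] [cite: Deligne1982HodgeCycles, §6 Prop. 6.1] -/
theorem cmSpreadingAt_of_isIsogenous_twoCMCurves (a b : ℕ) {A : AbelianVariety ℂ}
    (hA : A.IsIsogenous ((E₁.powSucc a).prod (E₂.powSucc b))) : CMSpreadingAt A :=
  cmSpreadingAt_of_hodgeConjectureFor (hodgeConjectureFor_of_isIsogenous_twoCMCurves hE₁ hE₂ hd₁ hd₂ hψ₁ hψ₂ hsq a b hA)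

/-- **The K3-partner cell at its CM fibres, `E` BIQUADRATIC: HC for `X ~ Y₀ × Z` with `Y₀ ~ E₁^{a+1} × E₂^{b+1}` and
`Z ~ E₁^{c+1} × E₂^{e+1}` — no Tankeev–Ribet, no `HC_CM`, no named fact.** At the `E × E` tori of the Shimura curve of
a type IV(2,1) fourfold `Y` with `End⁰(Y) = E = k₁ k₂ E⁺` the fibre is `Y_h ~ E_{k₁}² × E_{k₂}²` (both CM types induced
from `k₁`, `k₂`) and the K3 partner is `Z_Y ~ E_{k₁} × E_{k₂}`, so `X_h = Y_h × Z_Y` is the case `(1,1,0,0)`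
(RING2-MAP §deform D.41 (3); the kernel takes the isogeny shape as hypothesis). Companion of IX §2
`hodgeConjectureFor_of_isIsogenous_prod_sq_of_tankeevRibet` (`E` cyclic, mod TR).
[cite: MoonenZarhin1999LowDim, §3 Cor. (3.9) and §4 (quartic CM fields, arXiv p. 8)]
[cite: vanGeemen1994HodgeAV, Thm. 4.3 and Lemma 3.7] -/
theorem hodgeConjectureFor_of_isIsogenous_prod_of_twoCMCurves (a b c e : ℕ) {X Y₀ Z : AbelianVariety ℂ}
    (hX : X.IsIsogenous (Y₀.prod Z)) (hY : Y₀.IsIsogenous ((E₁.powSucc a).prod (E₂.powSucc b)))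
    (hZ : Z.IsIsogenous ((E₁.powSucc c).prod (E₂.powSucc e))) : HodgeConjectureFor X.dim X.X :=
  hodgeConjectureFor_of_isIsogenous_twoCMCurves_prod hE₁ hE₂ hd₁ hd₂ hψ₁ hψ₂ hsq a b c e (hX.trans (hY.prod hZ))

/-- … hence the localised row U holds at those fibres WITHOUT `HC_CM`: the K3-partner cell is `U`-only (KIND 1) at
`E` biquadratic IN THE KERNEL (gen 12 had it in print only, D.41 table row "(3) K3 partner, `E` biquadratic").
[cite: MoonenZarhin1999LowDim, §4 (quartic CM fields, arXiv p. 8)] [cite: Deligne1982HodgeCycles, §6 Prop. 6.1] -/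
theorem cmSpreadingAt_of_isIsogenous_prod_of_twoCMCurves (a b c e : ℕ) {X Y₀ Z : AbelianVariety ℂ}
    (hX : X.IsIsogenous (Y₀.prod Z)) (hY : Y₀.IsIsogenous ((E₁.powSucc a).prod (E₂.powSucc b)))
    (hZ : Z.IsIsogenous ((E₁.powSucc c).prod (E₂.powSucc e))) : CMSpreadingAt X :=
  cmSpreadingAt_of_hodgeConjectureFor
    (hodgeConjectureFor_of_isIsogenous_prod_of_twoCMCurves hE₁ hE₂ hd₁ hd₂ hψ₁ hψ₂ hsq a b c e hX hY hZ)

/-- **The Weil member (ii) of the K3-partner cell at its CM fibres: HC for `X ~ Y₀ × Z` with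
`Y₀ ~ E₁^{a+1} × E₂^{b+1}` and `Z ~ E₁^{c+1}`** — the members `Y × E_{k₁}²` (`E ∋ k₁` biquadratic, `Z ~ E_{k₁}²`) have
CM fibres `(E_{k₁}² × E_{k₂}²) × E_{k₁}²`, the case `(1,1,1)`; no Tankeev–Ribet, no `HC_CM`, no named fact (D.41 (3)
member (ii), gen 12: "print-free likewise"). [cite: MoonenZarhin1999LowDim, §3 Cor. (3.9) and §4]
[cite: vanGeemen1994HodgeAV, Thm. 4.3 and Lemma 3.7] -/
theorem hodgeConjectureFor_of_isIsogenous_prod_powSucc_of_twoCMCurves (a b c : ℕ) {X Y₀ Z : AbelianVariety ℂ}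
    (hX : X.IsIsogenous (Y₀.prod Z)) (hY : Y₀.IsIsogenous ((E₁.powSucc a).prod (E₂.powSucc b)))
    (hZ : Z.IsIsogenous (E₁.powSucc c)) : HodgeConjectureFor X.dim X.X :=
  hodgeConjectureFor_of_isIsogenous_twoCMCurves_prod_powSucc hE₁ hE₂ hd₁ hd₂ hψ₁ hψ₂ hsq a b c
    (hX.trans (hY.prod hZ))

/-- … and the localised row U at those fibres WITHOUT `HC_CM`.
[cite: MoonenZarhin1999LowDim, §4 (quartic CM fields, arXiv p. 8)] [cite: Deligne1982HodgeCycles, §6 Prop. 6.1] -/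
theorem cmSpreadingAt_of_isIsogenous_prod_powSucc_of_twoCMCurves (a b c : ℕ) {X Y₀ Z : AbelianVariety ℂ}
    (hX : X.IsIsogenous (Y₀.prod Z)) (hY : Y₀.IsIsogenous ((E₁.powSucc a).prod (E₂.powSucc b)))
    (hZ : Z.IsIsogenous (E₁.powSucc c)) : CMSpreadingAt X :=
  cmSpreadingAt_of_hodgeConjectureFor
    (hodgeConjectureFor_of_isIsogenous_prod_powSucc_of_twoCMCurves hE₁ hE₂ hd₁ hd₂ hψ₁ hψ₂ hsq a b c hX hY hZ)

/-! ## §2 — Two-CM-curve-charted invariant-cycles families (part X §1 with the anchors of §1) -/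

/-- **`E₁^{a+1} × E₂^{b+1}`-charted families (no named fact, no `HC_CM`)**: if (1.1) holds on `f` and one fibre is
charted by `A₀ ~ E₁^{a+1} × E₂^{b+1}`, the localised row U holds at EVERY fibre of `f`.
[cite: Abdulali1994FamiliesAV, (1.1) (p. 1122) and Lemma 6.2 (p. 1131)] [cite: vanGeemen1994HodgeAV, Thm. 4.3] -/
theorem cmSpreadingTo_of_invariantCycles_of_chart_of_isIsogenous_twoCMCurves {f : 𝒳 ⟶ S} {n : ℕ}
    (hIC : InvariantCyclesHoldFor f n) {s₀ : ComplexPoints S} (A₀ : AbelianVariety ℂ)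
    (e₀ : A₀.X ≅ fiberOver f s₀) (hdim : A₀.dim = n) (a b : ℕ)
    (hiso : A₀.IsIsogenous ((E₁.powSucc a).prod (E₂.powSucc b))) (s₁ : ComplexPoints S) :
    CMSpreadingTo f n s₁ :=
  cmSpreadingTo_of_invariantCycles_of_chart hIC e₀
    (hdim ▸ hodgeConjectureFor_of_isIsogenous_twoCMCurves hE₁ hE₂ hd₁ hd₂ hψ₁ hψ₂ hsq a b hiso) s₁

/-- … and HC holds at every Hodge-generic fibre of such a family.
[cite: Abdulali1994FamiliesAV, Lemma 6.2 (p. 1131)] [cite: CharlesSchnell2014Notes, Prop. 11.3.5]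
[cite: vanGeemen1994HodgeAV, Thm. 4.3] -/
theorem hodgeConjectureFor_fiber_of_invariantCycles_of_chart_of_isIsogenous_twoCMCurves_of_extend
    {f : 𝒳 ⟶ S} {n : ℕ} (hf : IsSmoothProjectiveFamily f n) (hIC : InvariantCyclesHoldFor f n)
    {s₀ : ComplexPoints S} (A₀ : AbelianVariety ℂ) (e₀ : A₀.X ≅ fiberOver f s₀) (hdim : A₀.dim = n)
    (a b : ℕ) (hiso : A₀.IsIsogenous ((E₁.powSucc a).prod (E₂.powSucc b))) {s : ComplexPoints S}
    (hs : HodgeClassesExtendAt f n s) : HodgeConjectureFor n (fiberOver f s) :=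
  hodgeConjectureFor_fiber_of_invariantCycles_of_chart_of_extend hf hIC e₀
    (hdim ▸ hodgeConjectureFor_of_isIsogenous_twoCMCurves hE₁ hE₂ hd₁ hd₂ hψ₁ hψ₂ hsq a b hiso) hs

/-- **The K3-partner family, `E` biquadratic, read through (1.1)**: if (1.1) holds on `f` and one fibre is charted
by `X₀ ~ Y₀ × Z`, `Y₀ ~ E₁^{a+1} × E₂^{b+1}`, `Z ~ E₁^{c+1} × E₂^{e+1}` (the CM sixfolds `Y_h × Z_Y` of D.41 (3):
`(1,1,0,0)`), the localised row U holds at EVERY fibre of `f` — no Tankeev–Ribet, no `HC_CM`, no fact.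
[cite: Abdulali1994FamiliesAV, (1.1) and Lemma 6.2] [cite: MoonenZarhin1999LowDim, §3 Cor. (3.9) and §4] -/
theorem cmSpreadingTo_of_invariantCycles_of_chart_prod_of_twoCMCurves {f : 𝒳 ⟶ S} {n : ℕ}
    (hIC : InvariantCyclesHoldFor f n) {s₀ : ComplexPoints S} (a b c e : ℕ) {X₀ Y₀ Z : AbelianVariety ℂ}
    (hX : X₀.IsIsogenous (Y₀.prod Z)) (hY : Y₀.IsIsogenous ((E₁.powSucc a).prod (E₂.powSucc b)))
    (hZ : Z.IsIsogenous ((E₁.powSucc c).prod (E₂.powSucc e))) (e₀ : X₀.X ≅ fiberOver f s₀)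
    (hdim : X₀.dim = n) (s₁ : ComplexPoints S) : CMSpreadingTo f n s₁ :=
  cmSpreadingTo_of_invariantCycles_of_chart hIC e₀
    (hdim ▸ hodgeConjectureFor_of_isIsogenous_prod_of_twoCMCurves hE₁ hE₂ hd₁ hd₂ hψ₁ hψ₂ hsq a b c e hX hY hZ)
    s₁

/-- … and HC holds at every HODGE-GENERIC fibre of such a family: on the (compact, one-dimensional) Mumford–Tate
family of the K3-partner sixfold `Y × Z_Y`, `E` biquadratic, HC(`Y × Z_Y`) ⟸ (1.1) on that ONE curve family —
RING2-MAP §deform D.46 with the print anchor replaced by the kernel's (this part).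
[cite: Abdulali1994FamiliesAV, Lemma 6.2 (p. 1131)] [cite: CharlesSchnell2014Notes, Prop. 11.3.5 and Thm. 11.5.11]
[cite: MoonenZarhin1999LowDim, §4] -/
theorem hodgeConjectureFor_fiber_of_invariantCycles_of_chart_prod_of_twoCMCurves_of_extend {f : 𝒳 ⟶ S}
    {n : ℕ} (hf : IsSmoothProjectiveFamily f n) (hIC : InvariantCyclesHoldFor f n) {s₀ : ComplexPoints S}
    (a b c e : ℕ) {X₀ Y₀ Z : AbelianVariety ℂ} (hX : X₀.IsIsogenous (Y₀.prod Z))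
    (hY : Y₀.IsIsogenous ((E₁.powSucc a).prod (E₂.powSucc b)))
    (hZ : Z.IsIsogenous ((E₁.powSucc c).prod (E₂.powSucc e))) (e₀ : X₀.X ≅ fiberOver f s₀)
    (hdim : X₀.dim = n) {s : ComplexPoints S} (hs : HodgeClassesExtendAt f n s) :
    HodgeConjectureFor n (fiberOver f s) :=
  hodgeConjectureFor_fiber_of_invariantCycles_of_chart_of_extend hf hIC e₀
    (hdim ▸ hodgeConjectureFor_of_isIsogenous_prod_of_twoCMCurves hE₁ hE₂ hd₁ hd₂ hψ₁ hψ₂ hsq a b c e hX hY hZ)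
    hs

/-- **The Weil member (ii) family read through (1.1)**: chart `X₀ ~ Y₀ × Z`, `Y₀ ~ E₁^{a+1} × E₂^{b+1}`,
`Z ~ E₁^{c+1}` (the CM fibres `(E_{k₁}² × E_{k₂}²) × E_{k₁}²` of `Y × E_{k₁}²`): (1.1) on `f` gives the localised
row U at every fibre — no Tankeev–Ribet, no `HC_CM`, no fact.
[cite: Abdulali1994FamiliesAV, (1.1) and Lemma 6.2] [cite: MoonenZarhin1999LowDim, §3 Cor. (3.9) and §4] -/
theorem cmSpreadingTo_of_invariantCycles_of_chart_prod_powSucc_of_twoCMCurves {f : 𝒳 ⟶ S} {n : ℕ}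
    (hIC : InvariantCyclesHoldFor f n) {s₀ : ComplexPoints S} (a b c : ℕ) {X₀ Y₀ Z : AbelianVariety ℂ}
    (hX : X₀.IsIsogenous (Y₀.prod Z)) (hY : Y₀.IsIsogenous ((E₁.powSucc a).prod (E₂.powSucc b)))
    (hZ : Z.IsIsogenous (E₁.powSucc c)) (e₀ : X₀.X ≅ fiberOver f s₀) (hdim : X₀.dim = n)
    (s₁ : ComplexPoints S) : CMSpreadingTo f n s₁ :=
  cmSpreadingTo_of_invariantCycles_of_chart hIC e₀
    (hdim ▸ hodgeConjectureFor_of_isIsogenous_prod_powSucc_of_twoCMCurves hE₁ hE₂ hd₁ hd₂ hψ₁ hψ₂ hsq a b c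
      hX hY hZ) s₁

/-- … and HC holds at every Hodge-generic fibre of such a family.
[cite: Abdulali1994FamiliesAV, Lemma 6.2 (p. 1131)] [cite: CharlesSchnell2014Notes, Prop. 11.3.5]
[cite: MoonenZarhin1999LowDim, §4] -/
theorem hodgeConjectureFor_fiber_of_invariantCycles_of_chart_prod_powSucc_of_twoCMCurves_of_extend
    {f : 𝒳 ⟶ S} {n : ℕ} (hf : IsSmoothProjectiveFamily f n) (hIC : InvariantCyclesHoldFor f n)
    {s₀ : ComplexPoints S} (a b c : ℕ) {X₀ Y₀ Z : AbelianVariety ℂ} (hX : X₀.IsIsogenous (Y₀.prod Z))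
    (hY : Y₀.IsIsogenous ((E₁.powSucc a).prod (E₂.powSucc b))) (hZ : Z.IsIsogenous (E₁.powSucc c))
    (e₀ : X₀.X ≅ fiberOver f s₀) (hdim : X₀.dim = n) {s : ComplexPoints S} (hs : HodgeClassesExtendAt f n s) :
    HodgeConjectureFor n (fiberOver f s) :=
  hodgeConjectureFor_fiber_of_invariantCycles_of_chart_of_extend hf hIC e₀
    (hdim ▸ hodgeConjectureFor_of_isIsogenous_prod_powSucc_of_twoCMCurves hE₁ hE₂ hd₁ hd₂ hψ₁ hψ₂ hsq a b c
      hX hY hZ) hs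

end TwoCMCurves

end Summit.HodgeConjecture.HodgeConjecture.Ring2.Deform

end
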